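/-
Copyright (c) 2026 the pub-hodgecm-mathlib formalisation cell (harness21).  Prover seat hodgecm-mathlib-K2E5-p17 (g7), Track B «K2-LIT»,
#184♮ = hLiu418 = `stmt-HodgeConjecture-24832`; #42S payer road, organ S1 (local Siegel–Weil spanning), shared row (R-a) `hcell`
(LEAD F0P6-plan (g14) BATCH #16 (2); K2Liu-p07 (g3) road map 2026-09-04T12:37:33Z; assembler K2Liu-p06 (g4) SPEC-S1 §3∕§4).  File 1 of 2: the matrix algebra.
-/
import Mathlib.LinearAlgebra.Matrix.NonsingularInverse
import Mathlib.Data.Matrix.Basis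
import Mathlib.Tactic.FinCases
import Mathlib.Tactic.LinearCombination
import Mathlib.Tactic.Ring
import HarnessLib

/-!
# Crux `HLiu418`, organ S1, row (R-a): THE MIDDLE BRUHAT CELL OF `U(2,2)`, FILE 1 — the `2 × 2` matrix algebra of the decomposition `g = p · w₁ · x`

Cell `hodgecm-mathlib`, crux item hLiu418 = `stmt-HodgeConjecture-24832`, route of record `HCCMUnconditional`; squad K2 ∕ K2Liu, prover K2E5-p17 (g7).
THEOREMS ONLY (no `def`, no instance, no notation, no named-fact hypothesis, no `sorry`); lane `--supports stmt-HodgeConjecture-24832 --as helper` (count-neutral).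

THE MATHEMATICS ([Kudla1994, §3]: the `P_Δ × P_Δ`-orbits on the doubled unitary group `H = U(W ⊕ W⁻)` are indexed by `rank C`; for `n = 2` the complement of
the big cell `P_Δ w_Δ N_Δ` (`C` invertible) is the closed cell `P_Δ` (`C = 0`) and the MIDDLE cell `P_Δ w₁ P_Δ` (`rank C = 1`), `w₁` the flip of one line).
This file is the GENERIC `2 × 2` linear algebra of the constructive proof, over a commutative ring `K` in which every non-zero element is a unit (the local
algebra `E ⊗ F_v` at a NON-SPLIT place) with an involution `σ` and a `σ`-fixed symmetric invertible `S` (the Gram matrix): in adapted coordinates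
`g = [[A, B], [C, D]]`, `w₁ = [[1 − P, P], [P, 1 − P]]`, `P = E_{ii}`, one looks for `y = [[a, b], [0, d]] ∈ P_Δ` with `C(g · y · w₁) = C a (1 − P) + (C b + D d) P = 0`;
then `p := g y w₁ ∈ P_Δ` and `g = p · w₁ · y⁻¹`.  The solution: `a` a FRAME (`C a = r · e_iᵀ`, `exists_frame`), `d = S⁻¹ (aᴴ)⁻¹ S` (forced by unitarity), and the
unipotent correction `b = a · S⁻¹ · (z E_{ii})` with `z = −S_{ii} μ`, where `D d e_i = μ r`, `σ μ = −μ` comes from the inverse unitarity relation `D S⁻¹ Cᴴ + C S⁻¹ Dᴴ = 0`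
(a rank-one `σ`-skew-hermitian matrix is `r ⊗ σ(μ r)`, `exists_smul_of_skew`); unitarity of `w₁` itself forces `S_{ij} = 0` (`j ≠ i`), used as the hypothesis `S₀₁ = 0`.
* §1 `exists_frame`, `exists_smul_of_skew`, `ctr_mul`, `ctr_ctr`, `map_nonsing_inv_of_map_eq`;
* §2 **`middleCell_core_zero`**, **`middleCell_core_one`** (the flip of line `0`, resp. `1`).
File 2 (`K2LiuLocalSWMiddleCellBruhat`) lifts the core to `H(F_v)` through ★ `ofAdapted` and delivers the `hcell` binder of ★ `K2LiuLocalSWRamifiedMiddleCell.offBigCell_comp_eq_of_cells`.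
HONEST LABEL: HC_CM is proved only modulo the 7 printed citations (2 remaining named inputs: hLiu418 = stmt-HodgeConjecture-24832, h413 = stmt-HodgeConjecture-24833) until
rung 0 closes; count-neutral helper, closes no item.

Search: Mathlib `Matrix.det_fin_two`, `Matrix.single`, the `Matrix.nonsing_inv` API, `RingHom.map_det`, `IsUnit.mul_right_eq_zero`; tree: global-field twin for general `n`
★ `K2LiuSiegelBruhatMiddleCellExhaustion` (rational points), local big cell ★ `K2LiuLocalSWBigCellDecomposition`; dedup `rg "middleCell_core|exists_smul_of_skew"` — none.
References: [Kudla1994] S. Kudla, *Splitting metaplectic covers of dual reductive pairs*, Israel J. Math. 87 (1994), §3 (Bruhat cells of the Siegel parabolic);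
[HarrisKudlaSweet1996] M. Harris, S. Kudla, W. Sweet, *Theta dichotomy for unitary groups*, J. AMS 9 (1996), §1 (1.11), (1.15).
-/

set_option autoImplicit false
-- the mandated namespace repeats `HodgeConjecture.HodgeConjecture`
set_option linter.dupNamespace false

namespace Summit.HodgeConjecture.HodgeConjecture.Cruxes.HLiu418.K2LiuLocalSWMiddleCellFrame

open Matrix

variable {K : Type*} [CommRing K]

/-! ## §1 Frames, proportionality, conjugate-transpose bookkeeping -/

/-- **THE FRAME**: over a commutative ring in which every non-zero element is a unit, a non-zero singular `2 × 2` matrix `C` admits, for each `i : Fin 2`, an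
invertible `a` with `C · a · (1 − E_{ii}) = 0` (the column `j ≠ i` of `C a` vanishes): the `j`-th column of `a` is a non-zero kernel vector of `C`, the `i`-th a
coordinate vector completing it to a basis. [cite: Kudla1994, §3] -/
theorem exists_frame (hK : ∀ z : K, z ≠ 0 → IsUnit z) (C : Matrix (Fin 2) (Fin 2) K) (hC : C ≠ 0) (hdet : C.det = 0) (i : Fin 2) :
    ∃ a : Matrix (Fin 2) (Fin 2) K, IsUnit a.det ∧ C * a * (1 - Matrix.single i i 1) = 0 := by
  rw [Matrix.det_fin_two] at hdet
  -- a kernel vector `κ ≠ 0` with an invertible completion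
  have key : ∃ κ τ : Fin 2 → K, IsUnit (τ 0 * κ 1 - τ 1 * κ 0) ∧ C 0 0 * κ 0 + C 0 1 * κ 1 = 0 ∧ C 1 0 * κ 0 + C 1 1 * κ 1 = 0 := by
    by_cases h00 : C 0 0 = 0
    · by_cases h01 : C 0 1 = 0
      · by_cases h10 : C 1 0 = 0
        · have h11 : C 1 1 ≠ 0 := by
            intro h11; apply hC; ext k l; fin_cases k <;> fin_cases l <;> assumption
          exact ⟨![-C 1 1, C 1 0], ![0, 1], by simpa [h10] using hK _ h11, by simp [h00, h01], by simp; ring⟩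
        · exact ⟨![-C 1 1, C 1 0], ![1, 0], by simpa using hK _ h10, by simp [h00, h01], by simp; ring⟩
      · refine ⟨![-C 0 1, C 0 0], ![0, 1], by simpa [h00] using hK _ h01, by simp; ring, ?_⟩
        simp; linear_combination hdet
    · refine ⟨![-C 0 1, C 0 0], ![1, 0], by simpa using hK _ h00, by simp; ring, ?_⟩
      simp; linear_combination hdet
  obtain ⟨κ, τ, hu, hκ0, hκ1⟩ := key
  fin_cases i
  · -- `i = 0`: column `1` of `a` is `κ`, column `0` is `τ`
    refine ⟨Matrix.of ![![τ 0, κ 0], ![τ 1, κ 1]], ?_, ?_⟩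
    · have : (Matrix.of ![![τ 0, κ 0], ![τ 1, κ 1]]).det = τ 0 * κ 1 - τ 1 * κ 0 := by rw [Matrix.det_fin_two]; simp; ring
      rw [this]; exact hu
    · ext k l
      fin_cases k <;> fin_cases l <;> simp [Matrix.mul_apply, Fin.sum_univ_two, Matrix.single, Matrix.one_apply] <;> assumption
  · -- `i = 1`: column `0` of `a` is `κ`, column `1` is `τ`
    refine ⟨Matrix.of ![![κ 0, τ 0], ![κ 1, τ 1]], ?_, ?_⟩
    · have : (Matrix.of ![![κ 0, τ 0], ![κ 1, τ 1]]).det = -(τ 0 * κ 1 - τ 1 * κ 0) := by rw [Matrix.det_fin_two]; simp; ring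
      rw [this]; exact hu.neg
    · ext k l
      fin_cases k <;> fin_cases l <;> simp [Matrix.mul_apply, Fin.sum_univ_two, Matrix.single, Matrix.one_apply] <;> assumption

/-- **RANK-ONE SKEW-HERMITIAN ⇒ PROPORTIONAL**: if `r ≠ 0` and `r_k σ(q_l) = −q_k σ(r_l)` for all `k, l` (the rank-one matrix `r · σ(q)ᵀ` is `σ`-skew-hermitian),
then `q = μ r` with `σ μ = −μ` (`μ = q_m ∕ r_m` at a non-zero coordinate `r_m`). [cite: Kudla1994, §3] -/
theorem exists_smul_of_skew (hK : ∀ z : K, z ≠ 0 → IsUnit z) (σ : K →+* K) {m : Type*} (r q : m → K) (hr : r ≠ 0)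
    (h : ∀ k l, r k * σ (q l) = -(q k * σ (r l))) : ∃ μ : K, σ μ = -μ ∧ ∀ k, q k = μ * r k := by
  obtain ⟨i, hi⟩ := Function.ne_iff.1 hr
  obtain ⟨u, hu⟩ := hK _ hi
  have hσu : IsUnit (σ (r i)) := (hK _ hi).map σ
  refine ⟨q i * ↑u⁻¹, ?_, fun k => ?_⟩
  · -- from `h i i`: `r_i σ(q_i) = − q_i σ(r_i)`
    have hii := h i i
    rw [map_mul]
    have hinv : σ (↑u⁻¹ : K) * σ (r i) = 1 := by rw [← map_mul, ← hu, Units.inv_mul, map_one]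
    -- multiply `hii` by `u⁻¹ · σ(u)⁻¹`
    have : σ (q i) = -(q i * ↑u⁻¹) * σ (r i) := by
      have h2 : (↑u⁻¹ : K) * (r i * σ (q i)) = ↑u⁻¹ * -(q i * σ (r i)) := by rw [hii]
      rw [← hu, ← mul_assoc, Units.inv_mul, one_mul] at h2
      rw [h2, hu]; ring
    calc σ (q i) * σ ↑u⁻¹ = -(q i * ↑u⁻¹) * (σ (r i) * σ ↑u⁻¹) := by rw [this]; ring
      _ = -(q i * ↑u⁻¹) := by rw [mul_comm (σ (r i)), hinv, mul_one]
  · have hki := h k i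
    -- `r_k σ(q_i) = −q_k σ(r_i)` and `σ(q_i) = −(q_i u⁻¹) σ(r_i)`; cancel the unit `σ(r_i)`
    have hii := h i i
    have e1 : σ (q i) = -(q i * ↑u⁻¹) * σ (r i) := by
      have h2 : (↑u⁻¹ : K) * (r i * σ (q i)) = ↑u⁻¹ * -(q i * σ (r i)) := by rw [hii]
      rw [← hu, ← mul_assoc, Units.inv_mul, one_mul] at h2
      rw [h2, hu]; ring
    rw [e1] at hki
    have h3 : (q k - q i * ↑u⁻¹ * r k) * σ (r i) = 0 := by linear_combination hki
    obtain ⟨w, hw⟩ := hσu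
    have h4 : (q k - q i * ↑u⁻¹ * r k) * ↑w * ↑w⁻¹ = 0 := by rw [hw, h3, zero_mul]
    rw [Units.mul_inv_cancel_right] at h4
    linear_combination h4

open Matrix

variable {K : Type*} [CommRing K]

/-- `((X Y).map σ)ᵀ = (Y.map σ)ᵀ (X.map σ)ᵀ` (the `σ`-conjugate transpose is an anti-homomorphism). [folklore] -/
theorem ctr_mul (σ : K →+* K) {l m n : Type*} [Fintype m] (X : Matrix l m K) (Y : Matrix m n K) :
    ((X * Y).map σ)ᵀ = (Y.map σ)ᵀ * (X.map σ)ᵀ := by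
  rw [Matrix.map_mul, Matrix.transpose_mul]

/-- the `σ`-conjugate transpose is an involution when `σ` is. [folklore] -/
theorem ctr_ctr (σ : K →+* K) (hσ : ∀ x, σ (σ x) = x) {m n : Type*} (X : Matrix m n K) : (((X.map σ)ᵀ).map σ)ᵀ = X := by
  ext i j; simp [hσ]

/-- the inverse of a `σ`-fixed invertible matrix is `σ`-fixed. [folklore] -/
theorem map_nonsing_inv_of_map_eq (σ : K →+* K) {m : Type*} [Fintype m] [DecidableEq m] {S : Matrix m m K} (hSσ : S.map σ = S) (hSu : IsUnit S.det) :
    (S⁻¹).map σ = S⁻¹ := by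
  symm
  refine Matrix.inv_eq_left_inv ?_
  calc (S⁻¹).map σ * S = (S⁻¹).map σ * S.map σ := by rw [hSσ]
    _ = (S⁻¹ * S).map σ := Matrix.map_mul.symm
    _ = 1 := by rw [Matrix.nonsing_inv_mul _ hSu, Matrix.map_one _ (map_zero σ) (map_one σ)]

/-! ## §2 The middle-cell core (flip of line `0`, of line `1`) -/

/-- **THE MIDDLE-CELL CORE for the flip of line `0`** (all matrices `2 × 2` over a commutative ring `K` in which non-zero elements are units, with an
involution `σ` and a `σ`-fixed symmetric invertible `S` with `S₀₁ = 0`): if `D S⁻¹ Cᴴ + C S⁻¹ Dᴴ = 0` (the inverse unitarity relation of `[[A, B], [C, D]]`), `C ≠ 0` and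
`det C = 0`, there are `a, b, d` with `[[a, b], [0, d]]` unitary for `antidiag(S, S)` (`aᴴ S d = S`, `dᴴ S a = S`, `dᴴ S b + bᴴ S d = 0`) and
`C a (1 − E₀₀) + (C b + D d) E₀₀ = 0` — i.e. `[[A, B], [C, D]] · [[a, b], [0, d]] · w₁` has vanishing `C`-block for the flip `w₁ = [[1 − E₀₀, E₀₀], [E₀₀, 1 − E₀₀]]`.
Construction: `a` = a frame (`exists_frame`), `d = S⁻¹ (aᴴ)⁻¹ S`, `b = a S⁻¹ (z E₀₀)` with `z = −S₀₀ μ`, `μ` the proportionality scalar of `exists_smul_of_skew`.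
[cite: Kudla1994, §3] [cite: HarrisKudlaSweet1996, §1 (1.11)] -/
theorem middleCell_core_zero (hK : ∀ z : K, z ≠ 0 → IsUnit z) (σ : K →+* K) (hσ : ∀ x, σ (σ x) = x)
    (S : Matrix (Fin 2) (Fin 2) K) (hSt : Sᵀ = S) (hSσ : S.map σ = S) (hSu : IsUnit S.det) (hS01 : S 0 1 = 0)
    (C D : Matrix (Fin 2) (Fin 2) K) (hrel : D * S⁻¹ * (C.map σ)ᵀ + C * S⁻¹ * (D.map σ)ᵀ = 0) (hC : C ≠ 0) (hdet : C.det = 0) :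
    ∃ a b d : Matrix (Fin 2) (Fin 2) K, IsUnit a.det ∧ IsUnit d.det ∧
      (a.map σ)ᵀ * S * d = S ∧ (d.map σ)ᵀ * S * a = S ∧ (d.map σ)ᵀ * S * b + (b.map σ)ᵀ * S * d = 0 ∧
      C * a * (1 - Matrix.single 0 0 1) + (C * b + D * d) * Matrix.single 0 0 1 = 0 := by
  -- `S` is diagonal with unit diagonal entries; so is `S⁻¹`
  have hS10 : S 1 0 = 0 := by rw [← hSt, Matrix.transpose_apply, hS01]
  have hdS : S.det = S 0 0 * S 1 1 := by rw [Matrix.det_fin_two, hS01, zero_mul, sub_zero]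
  have hS00u : IsUnit (S 0 0) := isUnit_of_mul_isUnit_left (hdS ▸ hSu)
  have hS11u : IsUnit (S 1 1) := isUnit_of_mul_isUnit_right (hdS ▸ hSu)
  have hSiS : S⁻¹ * S = 1 := Matrix.nonsing_inv_mul _ hSu
  have hSi01 : S⁻¹ 0 1 = 0 := by
    have e := congrFun (congrFun hSiS 0) 1
    simp [Matrix.mul_apply, Fin.sum_univ_two, hS01] at e
    exact (hS11u.mul_left_eq_zero).1 e
  have hSi10 : S⁻¹ 1 0 = 0 := by
    have e := congrFun (congrFun hSiS 1) 0
    simp [Matrix.mul_apply, Fin.sum_univ_two, hS10] at e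
    exact (hS00u.mul_left_eq_zero).1 e
  have hSi00 : S⁻¹ 0 0 * S 0 0 = 1 := by
    have e := congrFun (congrFun hSiS 0) 0
    simpa [Matrix.mul_apply, Fin.sum_univ_two, hS10] using e
  have hSiu : IsUnit (S⁻¹).det := (Matrix.isUnit_nonsing_inv_det_iff).2 hSu
  have hSit : (S⁻¹)ᵀ = S⁻¹ := by rw [Matrix.transpose_nonsing_inv, hSt]
  have hSiσ : (S⁻¹).map σ = S⁻¹ := map_nonsing_inv_of_map_eq σ hSσ hSu
  have hSct : (S.map σ)ᵀ = S := by rw [hSσ, hSt]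
  have hSict : ((S⁻¹).map σ)ᵀ = S⁻¹ := by rw [hSiσ, hSit]
  have hσS00 : σ (S 0 0) = S 0 0 := by simpa using congrFun (congrFun hSσ 0) 0
  -- the frame
  obtain ⟨a, hau, hCa⟩ := exists_frame hK C hC hdet 0
  obtain ⟨C₁, hC₁⟩ : ∃ C₁, C₁ = C * a := ⟨_, rfl⟩
  rw [← hC₁] at hCa
  have hC1c : ∀ k, C₁ k 1 = 0 := by
    intro k
    have e := congrFun (congrFun hCa k) 1
    simpa [Matrix.mul_apply, Fin.sum_univ_two, Matrix.single, Matrix.one_apply] using e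
  -- `r = column 0 of C a ≠ 0`
  obtain ⟨r, hr⟩ : ∃ r : Fin 2 → K, r = fun k => C₁ k 0 := ⟨_, rfl⟩
  have hr0 : r ≠ 0 := by
    intro h0
    have hC1z : C₁ = 0 := by
      ext k l; fin_cases l
      · simpa [hr] using congrFun h0 k
      · exact hC1c k
    apply hC
    calc C = C * a * a⁻¹ := by rw [Matrix.mul_nonsing_inv_cancel_right _ _ hau]
      _ = 0 := by rw [← hC₁, hC1z, Matrix.zero_mul]
  -- `â = ctr a`, `d = S⁻¹ â⁻¹ S`
  obtain ⟨ah, hah⟩ : ∃ ah, ah = (a.map σ)ᵀ := ⟨_, rfl⟩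
  have hahu : IsUnit ah.det := by
    rw [hah, Matrix.det_transpose, ← RingHom.mapMatrix_apply, ← RingHom.map_det]
    exact hau.map σ
  obtain ⟨d, hdd⟩ : ∃ d, d = S⁻¹ * ah⁻¹ * S := ⟨_, rfl⟩
  have hdu : IsUnit d.det := by
    rw [hdd, Matrix.det_mul, Matrix.det_mul]
    exact (hSiu.mul ((Matrix.isUnit_nonsing_inv_det_iff).2 hahu)).mul hSu
  have Y1 : ah * S * d = S := by
    rw [hdd, Matrix.mul_assoc, Matrix.mul_assoc, Matrix.mul_nonsing_inv_cancel_left _ _ hSu, Matrix.mul_nonsing_inv_cancel_left _ _ hahu]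
  have Y1' : (a.map σ)ᵀ * S * d = S := by rw [← hah]; exact Y1
  have Y2 : (d.map σ)ᵀ * S * a = S := by
    have h := congrArg (fun X => (X.map σ)ᵀ) Y1
    simp only [ctr_mul] at h
    rwa [hah, ctr_ctr σ hσ, hSct, ← Matrix.mul_assoc] at h
  have Y3 : d * S⁻¹ * ah = S⁻¹ := by
    rw [hdd, Matrix.mul_assoc (S⁻¹ * ah⁻¹), Matrix.mul_nonsing_inv _ hSu, Matrix.mul_one, Matrix.mul_assoc, Matrix.nonsing_inv_mul _ hahu,
      Matrix.mul_one]
  have Y4 : a * S⁻¹ * (d.map σ)ᵀ = S⁻¹ := by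
    have h : (d.map σ)ᵀ = S * a⁻¹ * S⁻¹ := by
      calc (d.map σ)ᵀ = (d.map σ)ᵀ * S * a * a⁻¹ * S⁻¹ := by
            rw [Matrix.mul_nonsing_inv_cancel_right _ _ hau, Matrix.mul_nonsing_inv_cancel_right _ _ hSu]
        _ = S * a⁻¹ * S⁻¹ := by rw [Y2]
    rw [h]
    simp only [Matrix.mul_assoc]
    rw [Matrix.nonsing_inv_mul_cancel_left _ _ hSu, Matrix.mul_nonsing_inv_cancel_left _ _ hau]
  -- the relation for `C₁ = C a`, `D₁ = D d`
  obtain ⟨D₁, hD₁⟩ : ∃ D₁, D₁ = D * d := ⟨_, rfl⟩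
  have hsharp : D₁ * S⁻¹ * (C₁.map σ)ᵀ + C₁ * S⁻¹ * (D₁.map σ)ᵀ = 0 := by
    rw [hD₁, hC₁, ctr_mul, ctr_mul, ← hah]
    calc D * d * S⁻¹ * (ah * (C.map σ)ᵀ) + C * a * S⁻¹ * ((d.map σ)ᵀ * (D.map σ)ᵀ)
        = D * (d * S⁻¹ * ah) * (C.map σ)ᵀ + C * (a * S⁻¹ * (d.map σ)ᵀ) * (D.map σ)ᵀ := by
          simp only [Matrix.mul_assoc]
      _ = 0 := by rw [Y3, Y4]; simpa only [Matrix.mul_assoc] using hrel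
  obtain ⟨q, hq⟩ : ∃ q : Fin 2 → K, q = fun k => D₁ k 0 := ⟨_, rfl⟩
  have hs' : IsUnit (S⁻¹ 0 0) := isUnit_iff_exists_inv.2 ⟨S 0 0, hSi00⟩
  have hskew : ∀ k l, r k * σ (q l) = -(q k * σ (r l)) := by
    intro k l
    have e := congrFun (congrFun hsharp k) l
    simp only [Matrix.add_apply, Matrix.mul_apply, Fin.sum_univ_two, Matrix.transpose_apply, Matrix.map_apply, hC1c, hSi01, hSi10,
      map_zero, mul_zero, add_zero, zero_mul, Matrix.zero_apply] at e
    have e' : S⁻¹ 0 0 * (D₁ k 0 * σ (C₁ l 0) + C₁ k 0 * σ (D₁ l 0)) = 0 := by linear_combination e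
    have e'' := (hs'.mul_right_eq_zero).1 e'
    rw [hr, hq]
    linear_combination e''
  obtain ⟨μ, hμσ, hμ⟩ := exists_smul_of_skew hK σ r q hr0 hskew
  simp only [hr, hq] at hμ
  -- the unipotent correction `b = a · S⁻¹ · z E₀₀`, `z = −S₀₀ μ`
  obtain ⟨z, hz⟩ : ∃ z : K, z = -(S 0 0 * μ) := ⟨_, rfl⟩
  have hzσ : z + σ z = 0 := by rw [hz, map_neg, map_mul, hσS00, hμσ]; ring
  obtain ⟨b, hb⟩ : ∃ b, b = a * (S⁻¹ * Matrix.single 0 0 z) := ⟨_, rfl⟩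
  have hZct : ((Matrix.single (0 : Fin 2) (0 : Fin 2) z).map σ)ᵀ = Matrix.single 0 0 (σ z) := by
    ext k l; fin_cases k <;> fin_cases l <;> simp [Matrix.single]
  refine ⟨a, b, d, hau, hdu, Y1', Y2, ?_, ?_⟩
  · -- `dᴴ S b + bᴴ S d = Z + Zᴴ = 0`
    have h1 : (d.map σ)ᵀ * S * b = Matrix.single 0 0 z := by
      rw [hb, ← Matrix.mul_assoc, Y2, Matrix.mul_nonsing_inv_cancel_left _ _ hSu]
    have h2 : (b.map σ)ᵀ * S * d = Matrix.single 0 0 (σ z) := by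
      rw [hb, ctr_mul, ctr_mul, hZct, hSict, Matrix.mul_assoc, Matrix.mul_assoc, ← Matrix.mul_assoc ((a.map σ)ᵀ), Y1',
        Matrix.nonsing_inv_mul_cancel_right _ _ hSu]
    rw [h1, h2, ← Matrix.single_add, hzσ, Matrix.single_zero]
  · -- the `C`-block of `M · Y · W₁`
    rw [← hC₁, hCa, zero_add, hb, ← Matrix.mul_assoc C a, ← hC₁, ← hD₁]
    ext k l
    have hent : (C₁ * (S⁻¹ * Matrix.single (0 : Fin 2) (0 : Fin 2) z) + D₁ : Matrix (Fin 2) (Fin 2) K) k 0 = 0 := by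
      simp only [Matrix.add_apply, Matrix.mul_apply, Fin.sum_univ_two, hC1c, hSi01, hSi10, zero_mul, add_zero, Matrix.single,
        Matrix.of_apply]
      simp
      rw [hz]
      linear_combination (-(C₁ k 0 * μ)) * hSi00 + hμ k
    simp only [Matrix.mul_apply, Fin.sum_univ_two, Matrix.zero_apply]
    fin_cases l
    · simpa [Matrix.single, Matrix.add_apply] using hent
    · simp [Matrix.single]

/-- **THE MIDDLE-CELL CORE for the flip of line `1`** (the statement of `middleCell_core_zero` with the roles of the indices `0, 1` exchanged: `E₁₁` in place
of `E₀₀`; same hypothesis `S₀₁ = 0`). [cite: Kudla1994, §3] [cite: HarrisKudlaSweet1996, §1 (1.11)] -/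
theorem middleCell_core_one (hK : ∀ z : K, z ≠ 0 → IsUnit z) (σ : K →+* K) (hσ : ∀ x, σ (σ x) = x)
    (S : Matrix (Fin 2) (Fin 2) K) (hSt : Sᵀ = S) (hSσ : S.map σ = S) (hSu : IsUnit S.det) (hS01 : S 0 1 = 0)
    (C D : Matrix (Fin 2) (Fin 2) K) (hrel : D * S⁻¹ * (C.map σ)ᵀ + C * S⁻¹ * (D.map σ)ᵀ = 0) (hC : C ≠ 0) (hdet : C.det = 0) :
    ∃ a b d : Matrix (Fin 2) (Fin 2) K, IsUnit a.det ∧ IsUnit d.det ∧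
      (a.map σ)ᵀ * S * d = S ∧ (d.map σ)ᵀ * S * a = S ∧ (d.map σ)ᵀ * S * b + (b.map σ)ᵀ * S * d = 0 ∧
      C * a * (1 - Matrix.single 1 1 1) + (C * b + D * d) * Matrix.single 1 1 1 = 0 := by
  -- `S` is diagonal with unit diagonal entries; so is `S⁻¹`
  have hS10 : S 1 0 = 0 := by rw [← hSt, Matrix.transpose_apply, hS01]
  have hdS : S.det = S 0 0 * S 1 1 := by rw [Matrix.det_fin_two, hS01, zero_mul, sub_zero]
  have hS00u : IsUnit (S 0 0) := isUnit_of_mul_isUnit_left (hdS ▸ hSu)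
  have hS11u : IsUnit (S 1 1) := isUnit_of_mul_isUnit_right (hdS ▸ hSu)
  have hSiS : S⁻¹ * S = 1 := Matrix.nonsing_inv_mul _ hSu
  have hSi01 : S⁻¹ 0 1 = 0 := by
    have e := congrFun (congrFun hSiS 0) 1
    simp [Matrix.mul_apply, Fin.sum_univ_two, hS01] at e
    exact (hS11u.mul_left_eq_zero).1 e
  have hSi10 : S⁻¹ 1 0 = 0 := by
    have e := congrFun (congrFun hSiS 1) 0
    simp [Matrix.mul_apply, Fin.sum_univ_two, hS10] at e
    exact (hS00u.mul_left_eq_zero).1 e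
  have hSi11 : S⁻¹ 1 1 * S 1 1 = 1 := by
    have e := congrFun (congrFun hSiS 1) 1
    simpa [Matrix.mul_apply, Fin.sum_univ_two, hS01] using e
  have hSiu : IsUnit (S⁻¹).det := (Matrix.isUnit_nonsing_inv_det_iff).2 hSu
  have hSit : (S⁻¹)ᵀ = S⁻¹ := by rw [Matrix.transpose_nonsing_inv, hSt]
  have hSiσ : (S⁻¹).map σ = S⁻¹ := map_nonsing_inv_of_map_eq σ hSσ hSu
  have hSct : (S.map σ)ᵀ = S := by rw [hSσ, hSt]
  have hSict : ((S⁻¹).map σ)ᵀ = S⁻¹ := by rw [hSiσ, hSit]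
  have hσS11 : σ (S 1 1) = S 1 1 := by simpa using congrFun (congrFun hSσ 1) 1
  -- the frame
  obtain ⟨a, hau, hCa⟩ := exists_frame hK C hC hdet 1
  obtain ⟨C₁, hC₁⟩ : ∃ C₁, C₁ = C * a := ⟨_, rfl⟩
  rw [← hC₁] at hCa
  have hC1c : ∀ k, C₁ k 0 = 0 := by
    intro k
    have e := congrFun (congrFun hCa k) 0
    simpa [Matrix.mul_apply, Fin.sum_univ_two, Matrix.single, Matrix.one_apply] using e
  -- `r = column 0 of C a ≠ 0`
  obtain ⟨r, hr⟩ : ∃ r : Fin 2 → K, r = fun k => C₁ k 1 := ⟨_, rfl⟩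
  have hr0 : r ≠ 0 := by
    intro h0
    have hC1z : C₁ = 0 := by
      ext k l; fin_cases l
      · exact hC1c k
      · simpa [hr] using congrFun h0 k
    apply hC
    calc C = C * a * a⁻¹ := by rw [Matrix.mul_nonsing_inv_cancel_right _ _ hau]
      _ = 0 := by rw [← hC₁, hC1z, Matrix.zero_mul]
  -- `â = ctr a`, `d = S⁻¹ â⁻¹ S`
  obtain ⟨ah, hah⟩ : ∃ ah, ah = (a.map σ)ᵀ := ⟨_, rfl⟩
  have hahu : IsUnit ah.det := by
    rw [hah, Matrix.det_transpose, ← RingHom.mapMatrix_apply, ← RingHom.map_det]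
    exact hau.map σ
  obtain ⟨d, hdd⟩ : ∃ d, d = S⁻¹ * ah⁻¹ * S := ⟨_, rfl⟩
  have hdu : IsUnit d.det := by
    rw [hdd, Matrix.det_mul, Matrix.det_mul]
    exact (hSiu.mul ((Matrix.isUnit_nonsing_inv_det_iff).2 hahu)).mul hSu
  have Y1 : ah * S * d = S := by
    rw [hdd, Matrix.mul_assoc, Matrix.mul_assoc, Matrix.mul_nonsing_inv_cancel_left _ _ hSu, Matrix.mul_nonsing_inv_cancel_left _ _ hahu]
  have Y1' : (a.map σ)ᵀ * S * d = S := by rw [← hah]; exact Y1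
  have Y2 : (d.map σ)ᵀ * S * a = S := by
    have h := congrArg (fun X => (X.map σ)ᵀ) Y1
    simp only [ctr_mul] at h
    rwa [hah, ctr_ctr σ hσ, hSct, ← Matrix.mul_assoc] at h
  have Y3 : d * S⁻¹ * ah = S⁻¹ := by
    rw [hdd, Matrix.mul_assoc (S⁻¹ * ah⁻¹), Matrix.mul_nonsing_inv _ hSu, Matrix.mul_one, Matrix.mul_assoc, Matrix.nonsing_inv_mul _ hahu,
      Matrix.mul_one]
  have Y4 : a * S⁻¹ * (d.map σ)ᵀ = S⁻¹ := by
    have h : (d.map σ)ᵀ = S * a⁻¹ * S⁻¹ := by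
      calc (d.map σ)ᵀ = (d.map σ)ᵀ * S * a * a⁻¹ * S⁻¹ := by
            rw [Matrix.mul_nonsing_inv_cancel_right _ _ hau, Matrix.mul_nonsing_inv_cancel_right _ _ hSu]
        _ = S * a⁻¹ * S⁻¹ := by rw [Y2]
    rw [h]
    simp only [Matrix.mul_assoc]
    rw [Matrix.nonsing_inv_mul_cancel_left _ _ hSu, Matrix.mul_nonsing_inv_cancel_left _ _ hau]
  -- the relation for `C₁ = C a`, `D₁ = D d`
  obtain ⟨D₁, hD₁⟩ : ∃ D₁, D₁ = D * d := ⟨_, rfl⟩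
  have hsharp : D₁ * S⁻¹ * (C₁.map σ)ᵀ + C₁ * S⁻¹ * (D₁.map σ)ᵀ = 0 := by
    rw [hD₁, hC₁, ctr_mul, ctr_mul, ← hah]
    calc D * d * S⁻¹ * (ah * (C.map σ)ᵀ) + C * a * S⁻¹ * ((d.map σ)ᵀ * (D.map σ)ᵀ)
        = D * (d * S⁻¹ * ah) * (C.map σ)ᵀ + C * (a * S⁻¹ * (d.map σ)ᵀ) * (D.map σ)ᵀ := by
          simp only [Matrix.mul_assoc]
      _ = 0 := by rw [Y3, Y4]; simpa only [Matrix.mul_assoc] using hrel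
  obtain ⟨q, hq⟩ : ∃ q : Fin 2 → K, q = fun k => D₁ k 1 := ⟨_, rfl⟩
  have hs' : IsUnit (S⁻¹ 1 1) := isUnit_iff_exists_inv.2 ⟨S 1 1, hSi11⟩
  have hskew : ∀ k l, r k * σ (q l) = -(q k * σ (r l)) := by
    intro k l
    have e := congrFun (congrFun hsharp k) l
    simp only [Matrix.add_apply, Matrix.mul_apply, Fin.sum_univ_two, Matrix.transpose_apply, Matrix.map_apply, hC1c, hSi01, hSi10,
      map_zero, mul_zero, add_zero, zero_mul, Matrix.zero_apply] at e
    have e' : S⁻¹ 1 1 * (D₁ k 1 * σ (C₁ l 1) + C₁ k 1 * σ (D₁ l 1)) = 0 := by linear_combination e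
    have e'' := (hs'.mul_right_eq_zero).1 e'
    rw [hr, hq]
    linear_combination e''
  obtain ⟨μ, hμσ, hμ⟩ := exists_smul_of_skew hK σ r q hr0 hskew
  simp only [hr, hq] at hμ
  -- the unipotent correction `b = a · S⁻¹ · z E₀₀`, `z = −S₀₀ μ`
  obtain ⟨z, hz⟩ : ∃ z : K, z = -(S 1 1 * μ) := ⟨_, rfl⟩
  have hzσ : z + σ z = 0 := by rw [hz, map_neg, map_mul, hσS11, hμσ]; ring
  obtain ⟨b, hb⟩ : ∃ b, b = a * (S⁻¹ * Matrix.single 1 1 z) := ⟨_, rfl⟩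
  have hZct : ((Matrix.single (1 : Fin 2) (1 : Fin 2) z).map σ)ᵀ = Matrix.single 1 1 (σ z) := by
    ext k l; fin_cases k <;> fin_cases l <;> simp [Matrix.single]
  refine ⟨a, b, d, hau, hdu, Y1', Y2, ?_, ?_⟩
  · -- `dᴴ S b + bᴴ S d = Z + Zᴴ = 0`
    have h1 : (d.map σ)ᵀ * S * b = Matrix.single 1 1 z := by
      rw [hb, ← Matrix.mul_assoc, Y2, Matrix.mul_nonsing_inv_cancel_left _ _ hSu]
    have h2 : (b.map σ)ᵀ * S * d = Matrix.single 1 1 (σ z) := by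
      rw [hb, ctr_mul, ctr_mul, hZct, hSict, Matrix.mul_assoc, Matrix.mul_assoc, ← Matrix.mul_assoc ((a.map σ)ᵀ), Y1',
        Matrix.nonsing_inv_mul_cancel_right _ _ hSu]
    rw [h1, h2, ← Matrix.single_add, hzσ, Matrix.single_zero]
  · -- the `C`-block of `M · Y · W₁`
    rw [← hC₁, hCa, zero_add, hb, ← Matrix.mul_assoc C a, ← hC₁, ← hD₁]
    ext k l
    have hent : (C₁ * (S⁻¹ * Matrix.single (1 : Fin 2) (1 : Fin 2) z) + D₁ : Matrix (Fin 2) (Fin 2) K) k 1 = 0 := by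
      simp only [Matrix.add_apply, Matrix.mul_apply, Fin.sum_univ_two, hC1c, hSi01, hSi10, zero_mul, add_zero, Matrix.single,
        Matrix.of_apply]
      simp
      rw [hz]
      linear_combination (-(C₁ k 1 * μ)) * hSi11 + hμ k
    simp only [Matrix.mul_apply, Fin.sum_univ_two, Matrix.zero_apply]
    fin_cases l
    · simp [Matrix.single]
    · simpa [Matrix.single, Matrix.add_apply] using hent

end Summit.HodgeConjecture.HodgeConjecture.Cruxes.HLiu418.K2LiuLocalSWMiddleCellFrame
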